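import Literature.Analysis.FluidPDE.PassiveVectorTensorDistorted
import Literature.Analysis.FluidPDE.LagrangianLatticeCarrierFrameChainRule
import Literature.Analysis.FunctionSpaces.TorusTestFunctionProofs
import HarnessLib

/-!
# Change of variables in the `H¹` viscous pairing under a measure-preserving self-map of the torus
# (frame form of `∫ ∇w : 𝔼 : ∇ψ`, with the conjugated tensor `𝔼^G`, `G = (∇X)⁻¹`)

Analysis/FluidPDE proof-support file (everything proved; no definitions, no named facts).

Let `𝔼` be a (possibly `x`-dependent) fourth-order viscosity tensor (`Torus.Visc4`), let
`w, ψ ∈ H¹(𝕋^d; ℝ^d)` with weak gradients `∂_a w`, `∂_b ψ ∈ L²`, and let `X : 𝕋^d → 𝕋^d` be a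
volume-preserving change of variables with Jacobian matrix `J(y)_{ac} = ∂_c X_a(y)` and pointwise
inverse `G(y)`, `J(y) G(y) = 1`.  Writing `ŵ = w ∘ X`, `ψ̂ = ψ ∘ X`, the chain rule reads
`∂_c ŵ_i = Σ_a J_{ac} (∂_a w_i) ∘ X`, equivalently `(∂_a w_i) ∘ X = Σ_c G_{ca} ∂_c ŵ_i`, and the
viscous pairing transforms as
`∫ Σ 𝔼(x)_{iajb} ∂_a w_i ∂_b ψ_j dx = ∫ Σ (𝔼(X y))^{G(y)}_{icje} ∂_c ŵ_i ∂_e ψ̂_j dy`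
`= ∫ Σ 𝔼(X y)_{iajb} (∇ŵ·G)_{ia} (∇ψ̂·G)_{jb} dy`,
`(𝔸^G)_{icje} = Σ_{a,b} G_{ca} 𝔸_{iajb} G_{eb}` (`Torus.Visc4.conj`) — the identity stated (in its scalar,
matrix-diffusivity form) by Armstrong–Vicol for the Lagrangian-coordinate ansatz, §4.1 (PDF p. 34:
"distortion of the diffusion by the inverse flows", the matrix `s_{m−1} = K_m ξ̂ (∇X ∘ X⁻¹ − I)`),
and by Giaquinta, Ch. III §2 (2.1)–(2.3), for divergence-form systems under changes of variables;
the Sobolev chain rule is Ziemer, Thm. 2.2.2 / Evans, §5.2.3 Thm. 1.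

Contents (generic dimension `d`; `J`, `G` arbitrary matrix fields with `J(y) G(y) = 1` in §1–§2):
* §1 POINTWISE ALGEBRA: `Torus.Visc4.sum_conj_mul_mul_eq` (`𝔸^G : ξ̂ : η̂ = 𝔸 : (ξ̂ G) : (η̂ G)`, no
  hypothesis) and `Torus.Visc4.sum_conj_chain_eq` (`J G = 1` ⇒ `𝔸^G : (ξJ) : (ηJ) = 𝔸 : ξ : η`);
* §2 MEASURE LEVEL: `Torus.integral_viscPairing_eq_integral_frame` — for ANY measure-preserving
  `X`, any measurable `𝔼`, `gw`, `gψ`: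
  `∫ Σ 𝔼 x iajb (gw a x)_i (gψ b x)_j = ∫ Σ (𝔼(X y))^{G y} icje (Σ_a J y a c (gw a (X y))_i) (Σ_b J y b e (gψ b (X y))_j)`
  (`MeasureTheory.integral_map` and §1); the inner sums are EXACTLY the weak gradient of `w ∘ X`
  produced by the tree's `H¹` chain rule `Torus.HasWeakPartialDeriv.comp_add_proj` (Z5);
* §3 THE `H¹` IDENTITY: `Torus.integral_viscPairing_comp_add_proj` — for `X = id + proj ∘ D` with `D`
  smooth and `X` measure preserving, `J y a c = δ_{ac} + ∂_c D_a(y)`, `J G = 1`, `w, ψ ∈ L²` with `L²`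
  weak gradients and ANY integrable weak gradients `ĝw`, `ĝψ` of `w ∘ X`, `ψ ∘ X`:
  `∫ Σ 𝔼 x iajb (gw a x)_i (gψ b x)_j = ∫ Σ (𝔼(X y))^{G y} icje (ĝw c y)_i (ĝψ e y)_j`
  (Z5 + uniqueness of weak derivatives `Torus.HasWeakPartialDeriv.unique_holds` + §2), with the
  distorted-gradient form `…_distort` and the energy (`w = ψ`, `Torus.gradForm`) and constant-tensor
  corollaries;
* §4 THE CARRIER INSTANCE `LagrangianLatticeCarrier.frameViscousPairing`: `X = E.X m t s` for a regular
  Lagrangian lattice carrier, `J y = Matrix.of fun a c => (E.flowDeriv m t s y e_c)_a` (the Summit's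
  `frameJac`), `G y = (J y)⁻¹` (the Summit's `frameG`) under `IsUnit (J y)`.

Consumer: cell `ad-ideate`, K1L_D `stmt-AnomalousDissipation-27980`, lead memo L7/L8 brick Z6 (FRAME
FORM of the cross density: viscous term `= ∫ (∇ŵ·DX⁻¹) : 𝔼 : (∇ψ̂·DX⁻¹)`) and the pushed-forward levels
of the K3L tower (ruling D26-8, queue item L3 of the literature seat).

## Mathlib / tree search

Tree: `Visc4`, `gradForm` (`PassiveVectorTensor`), `Visc4.conj`, `distort` (`PassiveVectorTensorDistorted`:
the conjugated tensor and the prose form of this identity in its module docstring, no theorem),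
`HasWeakPartialDeriv`, `HasWeakPartialDeriv.unique_holds` (`TorusTestFunction(Proofs)`),
`HasWeakPartialDeriv.comp_add_proj`, `memLp_comp_add_proj`, `LagrangianLatticeCarrier.frameChainRule`
(`LagrangianLatticeCarrierFrameChainRule`), `LevelRegular.measurePreserving_X` / `isSmooth_disp`
(`LagrangianLatticeCarrier`); `rg "conj (G" / "integral_map" Literature/Analysis/FluidPDE`: no
change-of-variables theorem for the pairing existed. Mathlib: `MeasureTheory.integral_map`,
`MeasurePreserving.map_eq`, `Finset.aestronglyMeasurable_fun_sum`, `Matrix.mul_nonsing_inv`,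
`Matrix.isUnit_iff_isUnit_det`, `Fintype.sum_prod_type`, `Finset.sum_comm`.

## References

* S. Armstrong, V. Vicol, *Anomalous diffusion by fractal homogenization*, Ann. PDE 11 (2025) /
  arXiv:2305.05048, §4.1 (Lagrangian coordinates; the distortion `∇X⁻¹` of the diffusion matrix),
  PDF p. 34. [`ArmstrongVicol2025`]
* M. Giaquinta, *Multiple integrals in the calculus of variations and nonlinear elliptic systems*
  (Princeton 1983), Ch. III §2 (2.1)–(2.3). [`Giaquinta1983MultipleIntegrals`]
* W. P. Ziemer, *Weakly Differentiable Functions* (Springer GTM 120, 1989), Thm. 2.2.2 (Sobolev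
  functions under bi-Lipschitz changes of variables). [`Ziemer1989`]
* L. C. Evans, *Partial Differential Equations*, 2nd ed. (AMS 2010), §5.2.1 (uniqueness of weak
  derivatives), §5.2.3 Thm. 1. [`Evans2010`]
-/

noncomputable section

open MeasureTheory Set Filter Function
open scoped ENNReal NNReal InnerProductSpace

namespace Literature.Analysis.FluidPDE

namespace Torus

open Literature.Analysis.FunctionSpaces Literature.Analysis.FunctionSpaces.Torus

variable {d : Type*} [Fintype d] [DecidableEq d]

/-! ## §1 Pointwise algebra: the conjugated tensor against frame gradients -/

section Pointwise

omit [Fintype d] [DecidableEq d] in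
/-- Reordering a fourfold finite sum: `Σ_c Σ_e Σ_a Σ_b = Σ_a Σ_b Σ_c Σ_e`. [folklore] -/
private theorem sum_comm_four₂₈ [Fintype d] {M : Type*} [AddCommMonoid M] (F : d → d → d → d → M) :
    ∑ c, ∑ e, ∑ a, ∑ b, F a b c e = ∑ a, ∑ b, ∑ c, ∑ e, F a b c e := by
  calc ∑ c, ∑ e, ∑ a, ∑ b, F a b c e = ∑ c, ∑ a, ∑ e, ∑ b, F a b c e :=
        Finset.sum_congr rfl fun c _ => Finset.sum_comm
    _ = ∑ a, ∑ c, ∑ e, ∑ b, F a b c e := Finset.sum_comm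
    _ = ∑ a, ∑ c, ∑ b, ∑ e, F a b c e :=
        Finset.sum_congr rfl fun a _ => Finset.sum_congr rfl fun c _ => Finset.sum_comm
    _ = ∑ a, ∑ b, ∑ c, ∑ e, F a b c e := Finset.sum_congr rfl fun a _ => Finset.sum_comm

omit [DecidableEq d] in
/-- **`𝔸^G : ξ̂ : η̂ = 𝔸 : (ξ̂ G) : (η̂ G)`** — pairing the conjugated tensor `(𝔸^G)_{icje} = Σ_{ab} G_{ca} 𝔸_{iajb} G_{eb}`
with two gradient matrices `ξ̂_{ic}`, `η̂_{je}` is pairing `𝔸` with the DISTORTED gradients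
`(ξ̂ G)_{ia} = Σ_c G_{ca} ξ̂_{ic}`, `(η̂ G)_{jb} = Σ_e G_{eb} η̂_{je}` (pure rearrangement of finite sums).
[cite: Giaquinta1983MultipleIntegrals, Ch. III §2 eq. (2.1)-(2.3)] [cite: ArmstrongVicol2025, §4.1 (s_{m−1}, T_{m−1}), PDF p. 34] -/
theorem Visc4.sum_conj_mul_mul_eq (G : Matrix d d ℝ) (𝔸 : Visc4 d) (ξ η : d → d → ℝ) :
    ∑ i, ∑ c, ∑ j, ∑ e, Visc4.conj G 𝔸 i c j e * ξ i c * η j e =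
      ∑ i, ∑ a, ∑ j, ∑ b, 𝔸 i a j b * (∑ c, G c a * ξ i c) * (∑ e, G e b * η j e) := by
  refine Finset.sum_congr rfl fun i _ => ?_
  conv_lhs => rw [Finset.sum_comm]
  conv_rhs => rw [Finset.sum_comm]
  refine Finset.sum_congr rfl fun j _ => ?_
  have hL : ∑ c, ∑ e, Visc4.conj G 𝔸 i c j e * ξ i c * η j e =
      ∑ c, ∑ e, ∑ a, ∑ b, G c a * 𝔸 i a j b * G e b * ξ i c * η j e := by
    refine Finset.sum_congr rfl fun c _ => Finset.sum_congr rfl fun e _ => ?_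
    rw [Visc4.conj_apply, Finset.sum_mul, Finset.sum_mul]
    refine Finset.sum_congr rfl fun a _ => ?_
    rw [Finset.sum_mul, Finset.sum_mul]
  have hR : ∑ a, ∑ b, 𝔸 i a j b * (∑ c, G c a * ξ i c) * (∑ e, G e b * η j e) =
      ∑ a, ∑ b, ∑ c, ∑ e, G c a * 𝔸 i a j b * G e b * ξ i c * η j e := by
    refine Finset.sum_congr rfl fun a _ => Finset.sum_congr rfl fun b _ => ?_
    rw [mul_assoc, Finset.sum_mul_sum, Finset.mul_sum]
    refine Finset.sum_congr rfl fun c _ => ?_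
    rw [Finset.mul_sum]
    exact Finset.sum_congr rfl fun e _ => by ring
  rw [hL, hR]
  exact sum_comm_four₂₈ (fun a b c e => G c a * 𝔸 i a j b * G e b * ξ i c * η j e)

/-- The inverse frame undoes the chain rule on one gradient slot: if `J G = 1` then
`Σ_c G_{ca} (Σ_{a'} J_{a'c} ξ_{ia'}) = ξ_{ia}` (`(ξ J) G = ξ (J G) = ξ`).
[cite: Giaquinta1983MultipleIntegrals, Ch. III §2 eq. (2.1)-(2.3)] -/
theorem Visc4.sum_mul_sum_mul_eq_of_mul_eq_one {J G : Matrix d d ℝ} (hJG : J * G = 1)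
    (ξ : d → d → ℝ) (i a : d) :
    ∑ c, G c a * (∑ a', J a' c * ξ i a') = ξ i a := by
  calc ∑ c, G c a * (∑ a', J a' c * ξ i a')
      = ∑ a', (∑ c, J a' c * G c a) * ξ i a' := by
        simp_rw [Finset.mul_sum, Finset.sum_mul]
        rw [Finset.sum_comm]
        exact Finset.sum_congr rfl fun a' _ => Finset.sum_congr rfl fun c _ => by ring
    _ = ∑ a', (J * G) a' a * ξ i a' := by simp only [Matrix.mul_apply]
    _ = ξ i a := by
        rw [hJG]
        simp only [Matrix.one_apply, ite_mul, one_mul, zero_mul, Finset.sum_ite_eq',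
          Finset.mem_univ, if_true]

/-- **`J G = 1 ⇒ 𝔸^G : (ξ J) : (η J) = 𝔸 : ξ : η`** — the conjugated tensor paired with the CHAIN-RULE
gradients `ξ̂_{ic} = Σ_a J_{ac} ξ_{ia}`, `η̂_{je} = Σ_b J_{be} η_{jb}` (`J_{ac} = ∂_c X_a`) returns the flat
pairing of `𝔸` with `ξ`, `η`: the pointwise content of the change of variables in `∫ ∇w : 𝔸 : ∇ψ`.
[cite: Giaquinta1983MultipleIntegrals, Ch. III §2 eq. (2.1)-(2.3)] [cite: ArmstrongVicol2025, §4.1 (s_{m−1}, T_{m−1}), PDF p. 34] -/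
theorem Visc4.sum_conj_chain_eq {J G : Matrix d d ℝ} (hJG : J * G = 1) (𝔸 : Visc4 d)
    (ξ η : d → d → ℝ) :
    ∑ i, ∑ c, ∑ j, ∑ e, Visc4.conj G 𝔸 i c j e * (∑ a, J a c * ξ i a) * (∑ b, J b e * η j b) =
      ∑ i, ∑ a, ∑ j, ∑ b, 𝔸 i a j b * ξ i a * η j b := by
  rw [Visc4.sum_conj_mul_mul_eq G 𝔸 (fun i c => ∑ a, J a c * ξ i a) (fun j e => ∑ b, J b e * η j b)]
  refine Finset.sum_congr rfl fun i _ => Finset.sum_congr rfl fun a _ =>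
    Finset.sum_congr rfl fun j _ => Finset.sum_congr rfl fun b _ => ?_
  rw [Visc4.sum_mul_sum_mul_eq_of_mul_eq_one hJG ξ i a, Visc4.sum_mul_sum_mul_eq_of_mul_eq_one hJG η j b]

omit [DecidableEq d] in
/-- The energy form `gradForm` is the diagonal of the pairing (unfolding).
[cite: Giaquinta1983MultipleIntegrals, Ch. III §2 eq. (2.1)-(2.3)] -/
theorem gradForm_eq_sum_mul_mul (𝔸 : Visc4 d) (ξ : d → d → ℝ) :
    gradForm 𝔸 ξ = ∑ i, ∑ a, ∑ j, ∑ b, 𝔸 i a j b * ξ i a * ξ j b := rfl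

end Pointwise

/-! ## §2 Measure level: the pairing under any measure-preserving self-map -/

section MeasureLevel

omit [DecidableEq d] in
/-- Components of a finite linear combination of vectors of `ℝ^d`: `(Σ_a c_a • v_a)_i = Σ_a c_a (v_a)_i`. [folklore] -/
private theorem sum_smul_apply_eq_sum_mul₂₈ (c : d → ℝ) (v : d → EuclideanSpace ℝ d) (i : d) :
    (∑ a, c a • v a) i = ∑ a, c a * v a i := by
  rw [WithLp.ofLp_sum, Finset.sum_apply]
  simp only [WithLp.ofLp_smul, Pi.smul_apply, smul_eq_mul]

omit [DecidableEq d] in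
/-- Measurability of the viscous-pairing (energy-form) integrand `x ↦ Σ 𝔼 x iajb (gw a x)_i (gψ b x)_j` of the
weak formulation `∫ A^{αβ}_{ij}(x) D_β u^j D_α φ^i` for measurable coefficients and gradients.
[cite: Giaquinta1983MultipleIntegrals, Ch. III §2 eq. (2.1)-(2.3)] -/
theorem aestronglyMeasurable_viscPairing {𝔼 : UnitAddTorus d → Visc4 d}
    (h𝔼 : ∀ i a j b, AEStronglyMeasurable (fun x => 𝔼 x i a j b) volume)
    {gw gψ : d → UnitAddTorus d → EuclideanSpace ℝ d}
    (hgw : ∀ a, AEStronglyMeasurable (gw a) volume) (hgψ : ∀ b, AEStronglyMeasurable (gψ b) volume) :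
    AEStronglyMeasurable (fun x => ∑ i, ∑ a, ∑ j, ∑ b, 𝔼 x i a j b * gw a x i * gψ b x j) volume := by
  have hwi : ∀ a i, AEStronglyMeasurable (fun x => gw a x i) volume := fun a i =>
    (PiLp.continuous_apply 2 (fun _ : d => ℝ) i).comp_aestronglyMeasurable (hgw a)
  have hψj : ∀ b j, AEStronglyMeasurable (fun x => gψ b x j) volume := fun b j =>
    (PiLp.continuous_apply 2 (fun _ : d => ℝ) j).comp_aestronglyMeasurable (hgψ b)
  refine Finset.aestronglyMeasurable_fun_sum _ fun i _ => Finset.aestronglyMeasurable_fun_sum _ fun a _ =>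
    Finset.aestronglyMeasurable_fun_sum _ fun j _ => Finset.aestronglyMeasurable_fun_sum _ fun b _ => ?_
  exact ((h𝔼 i a j b).mul (hwi a i)).mul (hψj b j)

/-- **Change of variables in the viscous pairing, frame form (measure level).** Let `X : 𝕋^d → 𝕋^d`
preserve volume, let `J, G` be matrix fields with `J(y) G(y) = 1`, and let `𝔼` (tensor field) and
`gw a`, `gψ b` (the flat gradient columns `∂_a w`, `∂_b ψ`) be measurable. Then
`∫ Σ 𝔼 x iajb (gw a x)_i (gψ b x)_j dx = ∫ Σ (𝔼(X y))^{G y} icje ĝw_{ic}(y) ĝψ_{je}(y) dy` with the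
CHAIN-RULE frame gradients `ĝw_{ic}(y) = Σ_a J y a c (gw a (X y))_i` (the weak gradient of `w ∘ X` when
`J = ∇X`, `Torus.HasWeakPartialDeriv.comp_add_proj`). Volume preservation moves `∫` through `X`
(`MeasureTheory.integral_map`); the integrands agree pointwise by `Visc4.sum_conj_chain_eq`.
[cite: ArmstrongVicol2025, §4.1 (s_{m−1}, T_{m−1}), PDF p. 34] [cite: Giaquinta1983MultipleIntegrals, Ch. III §2 eq. (2.1)-(2.3)] -/
theorem integral_viscPairing_eq_integral_frame {X : UnitAddTorus d → UnitAddTorus d}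
    (hX : MeasurePreserving X volume volume) {J G : UnitAddTorus d → Matrix d d ℝ}
    (hJG : ∀ y, J y * G y = 1) {𝔼 : UnitAddTorus d → Visc4 d}
    (h𝔼 : ∀ i a j b, AEStronglyMeasurable (fun x => 𝔼 x i a j b) volume)
    {gw gψ : d → UnitAddTorus d → EuclideanSpace ℝ d}
    (hgw : ∀ a, AEStronglyMeasurable (gw a) volume) (hgψ : ∀ b, AEStronglyMeasurable (gψ b) volume) :
    ∫ x, ∑ i, ∑ a, ∑ j, ∑ b, 𝔼 x i a j b * gw a x i * gψ b x j =
      ∫ y, ∑ i, ∑ c, ∑ j, ∑ e, Visc4.conj (G y) (𝔼 (X y)) i c j e *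
        (∑ a, J y a c * gw a (X y) i) * (∑ b, J y b e * gψ b (X y) j) := by
  set P : UnitAddTorus d → ℝ := fun x => ∑ i, ∑ a, ∑ j, ∑ b, 𝔼 x i a j b * gw a x i * gψ b x j with hP
  have hPm : AEStronglyMeasurable P volume := aestronglyMeasurable_viscPairing h𝔼 hgw hgψ
  -- pointwise: the frame integrand at `y` is `P (X y)`
  have hpt : ∀ y, ∑ i, ∑ c, ∑ j, ∑ e, Visc4.conj (G y) (𝔼 (X y)) i c j e *
      (∑ a, J y a c * gw a (X y) i) * (∑ b, J y b e * gψ b (X y) j) = P (X y) := fun y =>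
    Visc4.sum_conj_chain_eq (hJG y) (𝔼 (X y)) (fun i a => gw a (X y) i) (fun j b => gψ b (X y) j)
  simp_rw [hpt]
  -- `∫ P ∘ X = ∫ P` by volume preservation
  have hPm' : AEStronglyMeasurable P (Measure.map X volume) := by rwa [hX.map_eq]
  rw [← integral_map hX.measurable.aemeasurable hPm', hX.map_eq]

end MeasureLevel

/-! ## §3 The `H¹` identity through `X = id + proj ∘ D` -/

section HOne

/-- The explicit chain-rule weak gradient of `w ∘ X` (Z5) is square integrable: its columns are
bounded continuous combinations of `(∂_a w) ∘ X ∈ L²`. [cite: Evans2010, §5.2.3 Thm. 1] -/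
theorem memLp_sum_jac_smul_comp_add_proj {D : UnitAddTorus d → EuclideanSpace ℝ d} (hD : IsSmooth D)
    (hX : MeasurePreserving (fun y => y + proj (D y)) volume volume)
    {J : UnitAddTorus d → Matrix d d ℝ}
    (hJ : ∀ y a c, J y a c = (EuclideanSpace.single c (1 : ℝ)) a + (FunctionSpaces.Torus.partialDeriv c D y) a)
    {gw : d → UnitAddTorus d → EuclideanSpace ℝ d} (hgw : ∀ a, MemLp (gw a) 2 volume) (c : d) :
    MemLp (fun y => ∑ a, J y a c • gw a (y + proj (D y))) 2 volume := by
  have hcont : ∀ a, Continuous fun y => J y a c := by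
    intro a
    have e : (fun y => J y a c) = fun y => (EuclideanSpace.single c (1 : ℝ)) a + (FunctionSpaces.Torus.partialDeriv c D y) a :=
      funext fun y => hJ y a c
    rw [e]
    exact continuous_const.add ((PiLp.continuous_apply 2 (fun _ : d => ℝ) a).comp (hD.partialDeriv c).continuous)
  have hbdd : ∀ a, ∃ C : ℝ, ∀ y, ‖J y a c‖ ≤ C := by
    intro a
    obtain ⟨C, hC⟩ := (isCompact_univ.image (hcont a)).isBounded.exists_norm_le
    exact ⟨C, fun y => hC _ ⟨y, mem_univ _, rfl⟩⟩
  refine memLp_finsetSum _ fun a _ => ?_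
  obtain ⟨C, hC⟩ := hbdd a
  have hg : MemLp (fun y => gw a (y + proj (D y))) 2 volume := memLp_comp_add_proj hX (hgw a)
  exact hg.of_le_mul (c := C) ((hcont a).aestronglyMeasurable.smul hg.1)
    (ae_of_all _ fun y => by
      rw [norm_smul]
      exact mul_le_mul_of_nonneg_right (hC y) (norm_nonneg _))

/-- **The `H¹` change of variables in the viscous pairing (frame form).** Let `D : 𝕋^d → ℝ^d` be smooth
with `X = id + proj ∘ D` measure preserving, `J(y)_{ac} = δ_{ac} + ∂_c D_a(y)` (`= ∂_c X_a`) and `G` a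
pointwise inverse, `J(y) G(y) = 1`; let `𝔼` be a measurable tensor field; let `w, ψ ∈ L²(𝕋^d; ℝ^d)` have
`L²` weak gradients `gw a = ∂_a w`, `gψ b = ∂_b ψ`, and let `ĝw c`, `ĝψ e` be ANY integrable weak
gradients of `ŵ = w ∘ X`, `ψ̂ = ψ ∘ X`. Then
`∫ Σ 𝔼 x iajb (∂_a w)_i (∂_b ψ)_j dx = ∫ Σ (𝔼(X y))^{G y} icje (∂_c ŵ)_i (∂_e ψ̂)_j dy`.
Proof: the chain rule `Torus.HasWeakPartialDeriv.comp_add_proj` and uniqueness of weak derivatives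
identify `ĝw c` a.e. with `Σ_a J_{ac} (∂_a w) ∘ X`; then §2.
[cite: ArmstrongVicol2025, §4.1 (s_{m−1}, T_{m−1}), PDF p. 34] [cite: Ziemer1989, Thm. 2.2.2] [cite: Evans2010, §5.2.1 Lemma (Uniqueness of weak derivatives)] -/
theorem integral_viscPairing_comp_add_proj {D : UnitAddTorus d → EuclideanSpace ℝ d} (hD : IsSmooth D)
    (hX : MeasurePreserving (fun y => y + proj (D y)) volume volume)
    {J G : UnitAddTorus d → Matrix d d ℝ}
    (hJ : ∀ y a c, J y a c = (EuclideanSpace.single c (1 : ℝ)) a + (FunctionSpaces.Torus.partialDeriv c D y) a)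
    (hJG : ∀ y, J y * G y = 1) {𝔼 : UnitAddTorus d → Visc4 d}
    (h𝔼 : ∀ i a j b, AEStronglyMeasurable (fun x => 𝔼 x i a j b) volume)
    {w ψ : UnitAddTorus d → EuclideanSpace ℝ d} {gw gψ : d → UnitAddTorus d → EuclideanSpace ℝ d}
    (hw : MemLp w 2 volume) (hgw : ∀ a, MemLp (gw a) 2 volume) (hwg : ∀ a, HasWeakPartialDeriv a w (gw a))
    (hψ : MemLp ψ 2 volume) (hgψ : ∀ b, MemLp (gψ b) 2 volume) (hψg : ∀ b, HasWeakPartialDeriv b ψ (gψ b))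
    {ĝw ĝψ : d → UnitAddTorus d → EuclideanSpace ℝ d}
    (hĝwi : ∀ c, Integrable (ĝw c) volume)
    (hĝw : ∀ c, HasWeakPartialDeriv c (fun y => w (y + proj (D y))) (ĝw c))
    (hĝψi : ∀ e, Integrable (ĝψ e) volume)
    (hĝψ : ∀ e, HasWeakPartialDeriv e (fun y => ψ (y + proj (D y))) (ĝψ e)) :
    ∫ x, ∑ i, ∑ a, ∑ j, ∑ b, 𝔼 x i a j b * gw a x i * gψ b x j =
      ∫ y, ∑ i, ∑ c, ∑ j, ∑ e, Visc4.conj (G y) (𝔼 (y + proj (D y))) i c j e * ĝw c y i * ĝψ e y j := by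
  set X : UnitAddTorus d → UnitAddTorus d := fun y => y + proj (D y) with hXdef
  -- the explicit chain-rule gradients (Z5) and their a.e. identification with `ĝw`, `ĝψ`
  have hZw : ∀ c, HasWeakPartialDeriv c (fun y => w (X y)) (fun y => ∑ a, J y a c • gw a (X y)) := by
    intro c
    have h := HasWeakPartialDeriv.comp_add_proj hD hX hw hgw hwg c
    have e : (fun y => ∑ a, J y a c • gw a (X y)) =
        fun y => ∑ a, ((EuclideanSpace.single c (1 : ℝ)) a + (FunctionSpaces.Torus.partialDeriv c D y) a) • gw a (y + proj (D y)) :=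
      funext fun y => Finset.sum_congr rfl fun a _ => by rw [hJ y a c]
    rw [e]
    exact h
  have hZψ : ∀ e, HasWeakPartialDeriv e (fun y => ψ (X y)) (fun y => ∑ b, J y b e • gψ b (X y)) := by
    intro e'
    have h := HasWeakPartialDeriv.comp_add_proj hD hX hψ hgψ hψg e'
    have e : (fun y => ∑ b, J y b e' • gψ b (X y)) =
        fun y => ∑ b, ((EuclideanSpace.single e' (1 : ℝ)) b + (FunctionSpaces.Torus.partialDeriv e' D y) b) • gψ b (y + proj (D y)) :=
      funext fun y => Finset.sum_congr rfl fun b _ => by rw [hJ y b e']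
    rw [e]
    exact h
  have hZwi : ∀ c, Integrable (fun y => ∑ a, J y a c • gw a (X y)) volume := fun c =>
    (memLp_sum_jac_smul_comp_add_proj hD hX hJ hgw c).integrable one_le_two
  have hZψi : ∀ e, Integrable (fun y => ∑ b, J y b e • gψ b (X y)) volume := fun e =>
    (memLp_sum_jac_smul_comp_add_proj hD hX hJ hgψ e).integrable one_le_two
  have haew : ∀ c, (ĝw c) =ᵐ[volume] fun y => ∑ a, J y a c • gw a (X y) := fun c =>
    HasWeakPartialDeriv.unique_holds (EuclideanSpace ℝ d) (hĝwi c) (hZwi c) (hĝw c) (hZw c)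
  have haeψ : ∀ e, (ĝψ e) =ᵐ[volume] fun y => ∑ b, J y b e • gψ b (X y) := fun e =>
    HasWeakPartialDeriv.unique_holds (EuclideanSpace ℝ d) (hĝψi e) (hZψi e) (hĝψ e) (hZψ e)
  have hall : ∀ᵐ y ∂volume, (∀ c, ĝw c y = ∑ a, J y a c • gw a (X y)) ∧
      ∀ e, ĝψ e y = ∑ b, J y b e • gψ b (X y) := by
    refine (eventually_all.2 haew).and (eventually_all.2 haeψ)
  -- §2 and the a.e. identification
  rw [integral_viscPairing_eq_integral_frame hX hJG h𝔼 (fun a => (hgw a).1) (fun b => (hgψ b).1)]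
  refine integral_congr_ae ?_
  filter_upwards [hall] with y hy
  refine Finset.sum_congr rfl fun i _ => Finset.sum_congr rfl fun c _ =>
    Finset.sum_congr rfl fun j _ => Finset.sum_congr rfl fun e _ => ?_
  rw [hy.1 c, hy.2 e, sum_smul_apply_eq_sum_mul₂₈, sum_smul_apply_eq_sum_mul₂₈]

/-- **Distorted-gradient form** of `integral_viscPairing_comp_add_proj`:
`∫ Σ 𝔼 x iajb (∂_a w)_i (∂_b ψ)_j dx = ∫ Σ 𝔼(X y) iajb (∇ŵ·G)_{ia} (∇ψ̂·G)_{jb} dy`,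
`(∇ŵ·G)_{ia} = Σ_c G(y)_{ca} (∂_c ŵ)_i` — "the viscous term is `∫ (∇ŵ·DX⁻¹) : 𝔼∘X : (∇ψ̂·DX⁻¹)`".
[cite: ArmstrongVicol2025, §4.1 (s_{m−1}, T_{m−1}), PDF p. 34] [cite: Ziemer1989, Thm. 2.2.2] -/
theorem integral_viscPairing_comp_add_proj_distort {D : UnitAddTorus d → EuclideanSpace ℝ d}
    (hD : IsSmooth D) (hX : MeasurePreserving (fun y => y + proj (D y)) volume volume)
    {J G : UnitAddTorus d → Matrix d d ℝ}
    (hJ : ∀ y a c, J y a c = (EuclideanSpace.single c (1 : ℝ)) a + (FunctionSpaces.Torus.partialDeriv c D y) a)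
    (hJG : ∀ y, J y * G y = 1) {𝔼 : UnitAddTorus d → Visc4 d}
    (h𝔼 : ∀ i a j b, AEStronglyMeasurable (fun x => 𝔼 x i a j b) volume)
    {w ψ : UnitAddTorus d → EuclideanSpace ℝ d} {gw gψ : d → UnitAddTorus d → EuclideanSpace ℝ d}
    (hw : MemLp w 2 volume) (hgw : ∀ a, MemLp (gw a) 2 volume) (hwg : ∀ a, HasWeakPartialDeriv a w (gw a))
    (hψ : MemLp ψ 2 volume) (hgψ : ∀ b, MemLp (gψ b) 2 volume) (hψg : ∀ b, HasWeakPartialDeriv b ψ (gψ b))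
    {ĝw ĝψ : d → UnitAddTorus d → EuclideanSpace ℝ d}
    (hĝwi : ∀ c, Integrable (ĝw c) volume)
    (hĝw : ∀ c, HasWeakPartialDeriv c (fun y => w (y + proj (D y))) (ĝw c))
    (hĝψi : ∀ e, Integrable (ĝψ e) volume)
    (hĝψ : ∀ e, HasWeakPartialDeriv e (fun y => ψ (y + proj (D y))) (ĝψ e)) :
    ∫ x, ∑ i, ∑ a, ∑ j, ∑ b, 𝔼 x i a j b * gw a x i * gψ b x j =
      ∫ y, ∑ i, ∑ a, ∑ j, ∑ b, 𝔼 (y + proj (D y)) i a j b *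
        (∑ c, G y c a * ĝw c y i) * (∑ e, G y e b * ĝψ e y j) := by
  rw [integral_viscPairing_comp_add_proj hD hX hJ hJG h𝔼 hw hgw hwg hψ hgψ hψg hĝwi hĝw hĝψi hĝψ]
  refine integral_congr_ae (ae_of_all _ fun y => ?_)
  exact Visc4.sum_conj_mul_mul_eq (G y) (𝔼 (y + proj (D y))) (fun i c => ĝw c y i) (fun j e => ĝψ e y j)

/-- **Energy identity** (`w = ψ`): `∫ E_{𝔼(x)}(∇w) dx = ∫ E_{(𝔼(X y))^{G y}}(∇ŵ) dy` with the energy form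
`Torus.gradForm` — the dissipation of `w` in the flat problem equals the dissipation of `ŵ = w ∘ X`
measured with the conjugated tensor. [cite: ArmstrongVicol2025, §4.1 (s_{m−1}, T_{m−1}), PDF p. 34] [cite: Giaquinta1983MultipleIntegrals, Ch. III §2 eq. (2.1)-(2.3)] -/
theorem integral_gradForm_comp_add_proj {D : UnitAddTorus d → EuclideanSpace ℝ d} (hD : IsSmooth D)
    (hX : MeasurePreserving (fun y => y + proj (D y)) volume volume)
    {J G : UnitAddTorus d → Matrix d d ℝ}
    (hJ : ∀ y a c, J y a c = (EuclideanSpace.single c (1 : ℝ)) a + (FunctionSpaces.Torus.partialDeriv c D y) a)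
    (hJG : ∀ y, J y * G y = 1) {𝔼 : UnitAddTorus d → Visc4 d}
    (h𝔼 : ∀ i a j b, AEStronglyMeasurable (fun x => 𝔼 x i a j b) volume)
    {w : UnitAddTorus d → EuclideanSpace ℝ d} {gw : d → UnitAddTorus d → EuclideanSpace ℝ d}
    (hw : MemLp w 2 volume) (hgw : ∀ a, MemLp (gw a) 2 volume) (hwg : ∀ a, HasWeakPartialDeriv a w (gw a))
    {ĝw : d → UnitAddTorus d → EuclideanSpace ℝ d} (hĝwi : ∀ c, Integrable (ĝw c) volume)
    (hĝw : ∀ c, HasWeakPartialDeriv c (fun y => w (y + proj (D y))) (ĝw c)) :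
    ∫ x, gradForm (𝔼 x) (fun i a => gw a x i) =
      ∫ y, gradForm (Visc4.conj (G y) (𝔼 (y + proj (D y)))) (fun i c => ĝw c y i) := by
  simp only [gradForm_eq_sum_mul_mul]
  exact integral_viscPairing_comp_add_proj hD hX hJ hJG h𝔼 hw hgw hwg hw hgw hwg hĝwi hĝw hĝwi hĝw

/-- **Constant tensor**: for a CONSTANT viscosity tensor `𝔼` (the cell problems of the consumer),
`∫ Σ 𝔼 iajb (∂_a w)_i (∂_b ψ)_j = ∫ Σ (𝔼^{G y}) icje (∂_c ŵ)_i (∂_e ψ̂)_j dy`.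
[cite: ArmstrongVicol2025, §4.1 (s_{m−1}, T_{m−1}), PDF p. 34] [cite: Ziemer1989, Thm. 2.2.2] -/
theorem integral_viscPairing_comp_add_proj_const {D : UnitAddTorus d → EuclideanSpace ℝ d}
    (hD : IsSmooth D) (hX : MeasurePreserving (fun y => y + proj (D y)) volume volume)
    {J G : UnitAddTorus d → Matrix d d ℝ}
    (hJ : ∀ y a c, J y a c = (EuclideanSpace.single c (1 : ℝ)) a + (FunctionSpaces.Torus.partialDeriv c D y) a)
    (hJG : ∀ y, J y * G y = 1) (𝔼 : Visc4 d)
    {w ψ : UnitAddTorus d → EuclideanSpace ℝ d} {gw gψ : d → UnitAddTorus d → EuclideanSpace ℝ d}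
    (hw : MemLp w 2 volume) (hgw : ∀ a, MemLp (gw a) 2 volume) (hwg : ∀ a, HasWeakPartialDeriv a w (gw a))
    (hψ : MemLp ψ 2 volume) (hgψ : ∀ b, MemLp (gψ b) 2 volume) (hψg : ∀ b, HasWeakPartialDeriv b ψ (gψ b))
    {ĝw ĝψ : d → UnitAddTorus d → EuclideanSpace ℝ d}
    (hĝwi : ∀ c, Integrable (ĝw c) volume)
    (hĝw : ∀ c, HasWeakPartialDeriv c (fun y => w (y + proj (D y))) (ĝw c))
    (hĝψi : ∀ e, Integrable (ĝψ e) volume)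
    (hĝψ : ∀ e, HasWeakPartialDeriv e (fun y => ψ (y + proj (D y))) (ĝψ e)) :
    ∫ x, ∑ i, ∑ a, ∑ j, ∑ b, 𝔼 i a j b * gw a x i * gψ b x j =
      ∫ y, ∑ i, ∑ c, ∑ j, ∑ e, Visc4.conj (G y) 𝔼 i c j e * ĝw c y i * ĝψ e y j :=
  integral_viscPairing_comp_add_proj hD hX hJ hJG (𝔼 := fun _ => 𝔼) (fun _ _ _ _ => aestronglyMeasurable_const)
    hw hgw hwg hψ hgψ hψg hĝwi hĝw hĝψi hĝψ

end HOne

end Torus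

end Literature.Analysis.FluidPDE

/-! ## §4 The instance for the window flows of a regular Lagrangian lattice carrier -/

namespace Literature.Analysis.FluidPDE.LatticeShear.LagrangianLatticeCarrier

open Literature.Analysis.FunctionSpaces Literature.Analysis.FluidPDE

/-- The Jacobian matrix of the window flow read off `flowDeriv` is `δ_{ac} + ∂_c (disp)_a`:
`(E.flowDeriv m t s y e_c)_a = δ_{ac} + (∂_c (E.disp m t s) y)_a` (the Summit's `frameJac E m t s y a c`).
[cite: ArmstrongVicol2025, §2.2 (PDF p. 18: the flows X_m and their distortion ∇X_m)] -/
theorem flowDeriv_single_apply {k : ℕ} (E : LagrangianLatticeCarrier k) (hE : E.Regular) (m : ℕ) (t s : ℝ)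
    (y : UnitAddTorus (Fin 3)) (a c : Fin 3) :
    (E.flowDeriv m t s y (EuclideanSpace.single c (1 : ℝ))) a =
      (EuclideanSpace.single c (1 : ℝ)) a + (Torus.partialDeriv c (E.disp m t s) y) a := by
  have hD : Torus.IsSmooth (E.disp m t s) := hE.levelRegular.isSmooth_disp m t s
  rw [flowDeriv, _root_.add_apply, ContinuousLinearMap.id_apply, Torus.fderiv_lift, Torus.proj_repr,
    ← Torus.partialDeriv_eq_fderiv_apply (hD.isContDiff (by simp)), PiLp.add_apply]

/-- **The `H¹` viscous pairing in the frame of the coarse window flow of a regular Lagrangian lattice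
carrier.** For `E.Regular`, `X = E.X m t s` (`= id + proj ∘ E.disp m t s`, smooth, measure preserving),
the Jacobian matrix field `J y = (∂_c X_a(y))_{ac}` read off `E.flowDeriv m t s y` (the Summit's
`frameJac`) assumed invertible with inverse `G y = (J y)⁻¹` (the Summit's `frameG`), a constant tensor
`𝔼`, fields `w, ψ ∈ L²(𝕋³; ℝ³)` with `L²` weak gradients, and ANY integrable weak gradients `ĝw`, `ĝψ`
of `w ∘ X`, `ψ ∘ X`:
`∫ Σ 𝔼 iajb (∂_a w)_i (∂_b ψ)_j = ∫ Σ (𝔼^{G y}) icje (∂_c ŵ)_i (∂_e ψ̂)_j dy`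
and the distorted-gradient form `= ∫ Σ 𝔼 iajb (∇ŵ·G)_{ia} (∇ψ̂·G)_{jb} dy` (brick Z6 input, lead memo L8
of cell `ad-ideate`, stmt-AnomalousDissipation-27980).
[cite: ArmstrongVicol2025, §4.1 (s_{m−1}, T_{m−1}), PDF p. 34; §2.2 (PDF p. 18)] [cite: Ziemer1989, Thm. 2.2.2] -/
theorem frameViscousPairing {k : ℕ} (E : LagrangianLatticeCarrier k) (hE : E.Regular) (m : ℕ) (t s : ℝ)
    (hU : ∀ y, IsUnit (Matrix.of fun a c => (E.flowDeriv m t s y (EuclideanSpace.single c (1 : ℝ))) a))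
    (𝔼 : Torus.Visc4 (Fin 3))
    {w ψ : UnitAddTorus (Fin 3) → EuclideanSpace ℝ (Fin 3)}
    {gw gψ : Fin 3 → UnitAddTorus (Fin 3) → EuclideanSpace ℝ (Fin 3)}
    (hw : MemLp w 2 volume) (hgw : ∀ a, MemLp (gw a) 2 volume) (hwg : ∀ a, Torus.HasWeakPartialDeriv a w (gw a))
    (hψ : MemLp ψ 2 volume) (hgψ : ∀ b, MemLp (gψ b) 2 volume) (hψg : ∀ b, Torus.HasWeakPartialDeriv b ψ (gψ b))
    {ĝw ĝψ : Fin 3 → UnitAddTorus (Fin 3) → EuclideanSpace ℝ (Fin 3)}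
    (hĝwi : ∀ c, Integrable (ĝw c) volume)
    (hĝw : ∀ c, Torus.HasWeakPartialDeriv c (fun y => w (E.X m t s y)) (ĝw c))
    (hĝψi : ∀ e, Integrable (ĝψ e) volume)
    (hĝψ : ∀ e, Torus.HasWeakPartialDeriv e (fun y => ψ (E.X m t s y)) (ĝψ e)) :
    (∫ x, ∑ i, ∑ a, ∑ j, ∑ b, 𝔼 i a j b * gw a x i * gψ b x j =
      ∫ y, ∑ i, ∑ c, ∑ j, ∑ e,
        Torus.Visc4.conj (Matrix.of fun a c => (E.flowDeriv m t s y (EuclideanSpace.single c (1 : ℝ))) a)⁻¹ 𝔼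
          i c j e * ĝw c y i * ĝψ e y j) ∧
    (∫ x, ∑ i, ∑ a, ∑ j, ∑ b, 𝔼 i a j b * gw a x i * gψ b x j =
      ∫ y, ∑ i, ∑ a, ∑ j, ∑ b, 𝔼 i a j b *
        (∑ c, (Matrix.of fun a c => (E.flowDeriv m t s y (EuclideanSpace.single c (1 : ℝ))) a)⁻¹ c a * ĝw c y i) *
        (∑ e, (Matrix.of fun a c => (E.flowDeriv m t s y (EuclideanSpace.single c (1 : ℝ))) a)⁻¹ e b * ĝψ e y j)) := by
  set J : UnitAddTorus (Fin 3) → Matrix (Fin 3) (Fin 3) ℝ :=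
    fun y => Matrix.of fun a c => (E.flowDeriv m t s y (EuclideanSpace.single c (1 : ℝ))) a with hJdef
  have hD : Torus.IsSmooth (E.disp m t s) := hE.levelRegular.isSmooth_disp m t s
  have hX : MeasurePreserving (fun y => y + Torus.proj (E.disp m t s y)) volume volume :=
    hE.levelRegular.measurePreserving_X m t s
  have hJ : ∀ y a c, J y a c = (EuclideanSpace.single c (1 : ℝ)) a + (Torus.partialDeriv c (E.disp m t s) y) a :=
    fun y a c => by
      simp only [hJdef, Matrix.of_apply]
      exact flowDeriv_single_apply E hE m t s y a c
  have hJG : ∀ y, J y * (J y)⁻¹ = 1 := fun y =>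
    Matrix.mul_nonsing_inv _ ((Matrix.isUnit_iff_isUnit_det _).mp (hU y))
  have h𝔼 : ∀ i a j b : Fin 3, AEStronglyMeasurable (fun _ : UnitAddTorus (Fin 3) => 𝔼 i a j b) volume :=
    fun _ _ _ _ => aestronglyMeasurable_const
  refine ⟨?_, ?_⟩
  · exact Torus.integral_viscPairing_comp_add_proj hD hX hJ hJG (𝔼 := fun _ => 𝔼) h𝔼
      hw hgw hwg hψ hgψ hψg hĝwi hĝw hĝψi hĝψ
  · exact Torus.integral_viscPairing_comp_add_proj_distort hD hX hJ hJG (𝔼 := fun _ => 𝔼) h𝔼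
      hw hgw hwg hψ hgψ hψg hĝwi hĝw hĝψi hĝψ

end Literature.Analysis.FluidPDE.LatticeShear.LagrangianLatticeCarrier

/-! ## §5 (amendment 1) The transport / stretching pairing `∫ Σ uᵢ vₐ (∂ₐψ)ᵢ` in the frame

The trilinear pairing `∫ Σ_i Σ_a u_i(x) v_a(x) (∂_a ψ)_i(x) dx` — `(u, v) = (w, b)` is the transport term
`∫ ⟪w, (b·∇)ψ⟫`, `(u, v) = (b, w)` the stretching term `∫ ⟪b, (w·∇)ψ⟫` of the weak formulation — under
the same change of variables: `(∂_a ψ_i) ∘ X = Σ_c G_{ca} ∂_c ψ̂_i` turns `v_a (∂_a ψ)_i` into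
`(G · v∘X)_c (∂_c ψ̂)_i`, i.e. the carrier is replaced by its PULL-BACK `X^* v = (∇X)⁻¹ (v ∘ X)`
(`Torus.distort G (v ∘ X)`; Armstrong–Vicol §4.1: the Lagrangian-coordinate equation is driven by the
pulled-back residual field, here `b_{m−1}` → `level`), with no distortion of `u`. -/

namespace Literature.Analysis.FluidPDE.Torus

open Literature.Analysis.FunctionSpaces Literature.Analysis.FunctionSpaces.Torus

variable {d : Type*} [Fintype d] [DecidableEq d]

/-- The inverse frame against the chain rule, contracted with a vector: if `J G = 1` then
`Σ_c (Σ_a G_{ca} v_a) (Σ_{a'} J_{a'c} ξ_{ia'}) = Σ_a v_a ξ_{ia}` (`⟨G v, ξ̂_i⟩ = ⟨v, ξ_i⟩` for `ξ̂ = ξ J`).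
[cite: Giaquinta1983MultipleIntegrals, Ch. III §2 eq. (2.1)-(2.3)] [cite: ArmstrongVicol2025, §4.1 (s_{m−1}, T_{m−1}), PDF p. 34] -/
theorem sum_distort_mul_chain_eq {J G : Matrix d d ℝ} (hJG : J * G = 1) (v : d → ℝ) (ξ : d → d → ℝ)
    (i : d) : ∑ c, (∑ a, G c a * v a) * (∑ a', J a' c * ξ i a') = ∑ a, v a * ξ i a := by
  calc ∑ c, (∑ a, G c a * v a) * (∑ a', J a' c * ξ i a')
      = ∑ c, ∑ a, v a * (G c a * ∑ a', J a' c * ξ i a') := by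
        refine Finset.sum_congr rfl fun c _ => ?_
        rw [Finset.sum_mul]
        exact Finset.sum_congr rfl fun a _ => by ring
    _ = ∑ a, v a * ∑ c, G c a * ∑ a', J a' c * ξ i a' := by
        rw [Finset.sum_comm]
        exact Finset.sum_congr rfl fun a _ => by rw [Finset.mul_sum]
    _ = ∑ a, v a * ξ i a := Finset.sum_congr rfl fun a _ => by
        rw [Visc4.sum_mul_sum_mul_eq_of_mul_eq_one hJG ξ i a]

/-- Pointwise form of the transport change of variables: `J G = 1 ⇒ Σ_i Σ_c p_i (G v)_c (ξ J)_{ic} = Σ_i Σ_a p_i v_a ξ_{ia}`.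
[cite: Giaquinta1983MultipleIntegrals, Ch. III §2 eq. (2.1)-(2.3)] [cite: ArmstrongVicol2025, §4.1 (s_{m−1}, T_{m−1}), PDF p. 34] -/
theorem sum_sum_mul_distort_mul_chain_eq {J G : Matrix d d ℝ} (hJG : J * G = 1) (p v : d → ℝ)
    (ξ : d → d → ℝ) :
    ∑ i, ∑ c, p i * (∑ a, G c a * v a) * (∑ a', J a' c * ξ i a') = ∑ i, ∑ a, p i * v a * ξ i a := by
  refine Finset.sum_congr rfl fun i _ => ?_
  calc ∑ c, p i * (∑ a, G c a * v a) * (∑ a', J a' c * ξ i a')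
      = p i * ∑ c, (∑ a, G c a * v a) * (∑ a', J a' c * ξ i a') := by
        rw [Finset.mul_sum]
        exact Finset.sum_congr rfl fun c _ => by ring
    _ = p i * ∑ a, v a * ξ i a := by rw [sum_distort_mul_chain_eq hJG v ξ i]
    _ = ∑ a, p i * v a * ξ i a := by
        rw [Finset.mul_sum]
        exact Finset.sum_congr rfl fun a _ => by ring

omit [DecidableEq d] in
/-- `⟪p, Σ_a c_a • q_a⟫ = Σ_i Σ_a p_i c_a (q_a)_i` in `ℝ^d`. [folklore] -/
private theorem inner_sum_smul_eq₂₈ (p : EuclideanSpace ℝ d) (c : d → ℝ) (q : d → EuclideanSpace ℝ d) :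
    ⟪p, ∑ a, c a • q a⟫_ℝ = ∑ i, ∑ a, p i * c a * q a i := by
  rw [PiLp.inner_apply]
  refine Finset.sum_congr rfl fun i _ => ?_
  rw [sum_smul_apply_eq_sum_mul₂₈]
  simp only [RCLike.inner_apply, conj_trivial, Finset.sum_mul]
  exact Finset.sum_congr rfl fun a _ => by ring

omit [DecidableEq d] in
/-- Measurability of the transport/stretching integrand `x ↦ Σ_i Σ_a u_i v_a (∂_a ψ)_i` (the trilinear form
`b(u, v, w)` of the weak formulation) for measurable fields.
[cite: Temam1997, Ch. II §3.1–3.2, (3.2)–(3.5), Thm. 3.1] -/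
theorem aestronglyMeasurable_transportPairing {u v : UnitAddTorus d → EuclideanSpace ℝ d}
    (hu : AEStronglyMeasurable u volume) (hv : AEStronglyMeasurable v volume)
    {gψ : d → UnitAddTorus d → EuclideanSpace ℝ d} (hgψ : ∀ a, AEStronglyMeasurable (gψ a) volume) :
    AEStronglyMeasurable (fun x => ∑ i, ∑ a, u x i * v x a * gψ a x i) volume := by
  have hui : ∀ i, AEStronglyMeasurable (fun x => u x i) volume := fun i =>
    (PiLp.continuous_apply 2 (fun _ : d => ℝ) i).comp_aestronglyMeasurable hu
  have hva : ∀ a, AEStronglyMeasurable (fun x => v x a) volume := fun a =>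
    (PiLp.continuous_apply 2 (fun _ : d => ℝ) a).comp_aestronglyMeasurable hv
  have hψi : ∀ a i, AEStronglyMeasurable (fun x => gψ a x i) volume := fun a i =>
    (PiLp.continuous_apply 2 (fun _ : d => ℝ) i).comp_aestronglyMeasurable (hgψ a)
  refine Finset.aestronglyMeasurable_fun_sum _ fun i _ => Finset.aestronglyMeasurable_fun_sum _ fun a _ => ?_
  exact ((hui i).mul (hva a)).mul (hψi a i)

/-- **Change of variables in the transport/stretching pairing, frame form (measure level).** For a
measure-preserving `X`, matrix fields with `J(y) G(y) = 1`, and measurable `u, v, gψ`: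
`∫ Σ_i Σ_a u_i v_a (gψ a)_i dx = ∫ Σ_i Σ_c u(X y)_i (G y · v(X y))_c (Σ_{a'} J y a' c (gψ a' (X y))_i) dy` —
the carrier `v` is replaced by its pull-back `(∇X)⁻¹ (v ∘ X)`, the gradient by the chain-rule gradient
of `ψ ∘ X`, and `u` is merely composed with `X`.
[cite: ArmstrongVicol2025, §4.1 (s_{m−1}, T_{m−1}), PDF p. 34] [cite: Temam1997, Ch. II §3.1–3.2, (3.2)–(3.5), Thm. 3.1] -/
theorem integral_transportPairing_eq_integral_frame {X : UnitAddTorus d → UnitAddTorus d}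
    (hX : MeasurePreserving X volume volume) {J G : UnitAddTorus d → Matrix d d ℝ}
    (hJG : ∀ y, J y * G y = 1) {u v : UnitAddTorus d → EuclideanSpace ℝ d}
    (hu : AEStronglyMeasurable u volume) (hv : AEStronglyMeasurable v volume)
    {gψ : d → UnitAddTorus d → EuclideanSpace ℝ d} (hgψ : ∀ a, AEStronglyMeasurable (gψ a) volume) :
    ∫ x, ∑ i, ∑ a, u x i * v x a * gψ a x i =
      ∫ y, ∑ i, ∑ c, u (X y) i * (∑ a, G y c a * v (X y) a) * (∑ a', J y a' c * gψ a' (X y) i) := by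
  set P : UnitAddTorus d → ℝ := fun x => ∑ i, ∑ a, u x i * v x a * gψ a x i with hP
  have hPm : AEStronglyMeasurable P volume := aestronglyMeasurable_transportPairing hu hv hgψ
  have hpt : ∀ y, ∑ i, ∑ c, u (X y) i * (∑ a, G y c a * v (X y) a) * (∑ a', J y a' c * gψ a' (X y) i) =
      P (X y) := fun y =>
    sum_sum_mul_distort_mul_chain_eq (hJG y) (fun i => u (X y) i) (fun a => v (X y) a) (fun i a => gψ a (X y) i)
  simp_rw [hpt]
  have hPm' : AEStronglyMeasurable P (Measure.map X volume) := by rwa [hX.map_eq]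
  rw [← integral_map hX.measurable.aemeasurable hPm', hX.map_eq]

/-- **Uniqueness form of the `H¹` chain rule**: ANY integrable weak `c`-th partial derivative `ĝψ c` of
`ψ ∘ X`, `X = id + proj ∘ D` (smooth, measure preserving), agrees a.e. with the chain-rule gradient
`y ↦ Σ_a J(y)_{ac} (∂_a ψ)(X y)`, `J(y)_{ac} = δ_{ac} + ∂_c D_a(y)`, of `Torus.HasWeakPartialDeriv.comp_add_proj`.
[cite: Ziemer1989, Thm. 2.2.2] [cite: Evans2010, §5.2.1 Lemma (Uniqueness of weak derivatives)] -/
theorem ae_eq_sum_jac_smul_comp_add_proj {D : UnitAddTorus d → EuclideanSpace ℝ d} (hD : IsSmooth D)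
    (hX : MeasurePreserving (fun y => y + proj (D y)) volume volume)
    {J : UnitAddTorus d → Matrix d d ℝ}
    (hJ : ∀ y a c, J y a c = (EuclideanSpace.single c (1 : ℝ)) a + (FunctionSpaces.Torus.partialDeriv c D y) a)
    {ψ : UnitAddTorus d → EuclideanSpace ℝ d} {gψ : d → UnitAddTorus d → EuclideanSpace ℝ d}
    (hψ : MemLp ψ 2 volume) (hgψ : ∀ a, MemLp (gψ a) 2 volume) (hψg : ∀ a, HasWeakPartialDeriv a ψ (gψ a))
    {ĝψ : d → UnitAddTorus d → EuclideanSpace ℝ d} (hĝψi : ∀ c, Integrable (ĝψ c) volume)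
    (hĝψ : ∀ c, HasWeakPartialDeriv c (fun y => ψ (y + proj (D y))) (ĝψ c)) (c : d) :
    ĝψ c =ᵐ[volume] fun y => ∑ a, J y a c • gψ a (y + proj (D y)) := by
  have hZ : HasWeakPartialDeriv c (fun y => ψ (y + proj (D y))) (fun y => ∑ a, J y a c • gψ a (y + proj (D y))) := by
    have h := HasWeakPartialDeriv.comp_add_proj hD hX hψ hgψ hψg c
    have e : (fun y => ∑ a, J y a c • gψ a (y + proj (D y))) =
        fun y => ∑ a, ((EuclideanSpace.single c (1 : ℝ)) a + (FunctionSpaces.Torus.partialDeriv c D y) a) •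
          gψ a (y + proj (D y)) :=
      funext fun y => Finset.sum_congr rfl fun a _ => by rw [hJ y a c]
    rw [e]
    exact h
  exact HasWeakPartialDeriv.unique_holds (EuclideanSpace ℝ d) (hĝψi c)
    ((memLp_sum_jac_smul_comp_add_proj hD hX hJ hgψ c).integrable one_le_two) (hĝψ c) hZ

/-- **The `H¹` change of variables in the transport/stretching pairing (frame form).** `D` smooth,
`X = id + proj ∘ D` measure preserving, `J(y)_{ac} = δ_{ac} + ∂_c D_a(y)`, `J G = 1`; `u, v` measurable
vector fields; `ψ ∈ L²` with `L²` weak gradients `gψ a = ∂_a ψ` and ANY integrable weak gradients `ĝψ c`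
of `ψ̂ = ψ ∘ X`. Then
`∫ Σ_i Σ_a u_i v_a (∂_a ψ)_i dx = ∫ Σ_i Σ_c u(X y)_i (G(y) v(X y))_c (∂_c ψ̂)_i(y) dy`
("`∫ ⟪u, (v·∇)ψ⟫ = ∫ ⟪u∘X, ((∇X)⁻¹ v∘X · ∇) ψ̂⟫`").
[cite: ArmstrongVicol2025, §4.1 (s_{m−1}, T_{m−1}), PDF p. 34] [cite: Ziemer1989, Thm. 2.2.2] [cite: Temam1997, Ch. II §3.1–3.2, (3.2)–(3.5), Thm. 3.1] -/
theorem integral_transportPairing_comp_add_proj {D : UnitAddTorus d → EuclideanSpace ℝ d}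
    (hD : IsSmooth D) (hX : MeasurePreserving (fun y => y + proj (D y)) volume volume)
    {J G : UnitAddTorus d → Matrix d d ℝ}
    (hJ : ∀ y a c, J y a c = (EuclideanSpace.single c (1 : ℝ)) a + (FunctionSpaces.Torus.partialDeriv c D y) a)
    (hJG : ∀ y, J y * G y = 1) {u v : UnitAddTorus d → EuclideanSpace ℝ d}
    (hu : AEStronglyMeasurable u volume) (hv : AEStronglyMeasurable v volume)
    {ψ : UnitAddTorus d → EuclideanSpace ℝ d} {gψ : d → UnitAddTorus d → EuclideanSpace ℝ d}
    (hψ : MemLp ψ 2 volume) (hgψ : ∀ a, MemLp (gψ a) 2 volume) (hψg : ∀ a, HasWeakPartialDeriv a ψ (gψ a))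
    {ĝψ : d → UnitAddTorus d → EuclideanSpace ℝ d} (hĝψi : ∀ c, Integrable (ĝψ c) volume)
    (hĝψ : ∀ c, HasWeakPartialDeriv c (fun y => ψ (y + proj (D y))) (ĝψ c)) :
    ∫ x, ∑ i, ∑ a, u x i * v x a * gψ a x i =
      ∫ y, ∑ i, ∑ c, u (y + proj (D y)) i * (∑ a, G y c a * v (y + proj (D y)) a) * ĝψ c y i := by
  have hall : ∀ᵐ y ∂volume, ∀ c, ĝψ c y = ∑ a, J y a c • gψ a (y + proj (D y)) :=
    eventually_all.2 fun c => ae_eq_sum_jac_smul_comp_add_proj hD hX hJ hψ hgψ hψg hĝψi hĝψ c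
  rw [integral_transportPairing_eq_integral_frame hX hJG hu hv (fun a => (hgψ a).1)]
  refine integral_congr_ae ?_
  filter_upwards [hall] with y hy
  refine Finset.sum_congr rfl fun i _ => Finset.sum_congr rfl fun c _ => ?_
  rw [hy c, sum_smul_apply_eq_sum_mul₂₈]

/-- **Inner-product spelling**: `∫ ⟪u, Σ_a v_a • ∂_a ψ⟫ = ∫ ⟪u ∘ X, Σ_c (G · v∘X)_c • ∂_c ψ̂⟫`, the
pulled-back carrier written with `Torus.distort G (v ∘ X)`.
[cite: ArmstrongVicol2025, §4.1 (s_{m−1}, T_{m−1}), PDF p. 34] [cite: Temam1997, Ch. II §3.1–3.2, (3.2)–(3.5), Thm. 3.1] -/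
theorem integral_inner_sum_smul_comp_add_proj {D : UnitAddTorus d → EuclideanSpace ℝ d}
    (hD : IsSmooth D) (hX : MeasurePreserving (fun y => y + proj (D y)) volume volume)
    {J G : UnitAddTorus d → Matrix d d ℝ}
    (hJ : ∀ y a c, J y a c = (EuclideanSpace.single c (1 : ℝ)) a + (FunctionSpaces.Torus.partialDeriv c D y) a)
    (hJG : ∀ y, J y * G y = 1) {u v : UnitAddTorus d → EuclideanSpace ℝ d}
    (hu : AEStronglyMeasurable u volume) (hv : AEStronglyMeasurable v volume)
    {ψ : UnitAddTorus d → EuclideanSpace ℝ d} {gψ : d → UnitAddTorus d → EuclideanSpace ℝ d}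
    (hψ : MemLp ψ 2 volume) (hgψ : ∀ a, MemLp (gψ a) 2 volume) (hψg : ∀ a, HasWeakPartialDeriv a ψ (gψ a))
    {ĝψ : d → UnitAddTorus d → EuclideanSpace ℝ d} (hĝψi : ∀ c, Integrable (ĝψ c) volume)
    (hĝψ : ∀ c, HasWeakPartialDeriv c (fun y => ψ (y + proj (D y))) (ĝψ c)) :
    ∫ x, ⟪u x, ∑ a, v x a • gψ a x⟫_ℝ =
      ∫ y, ⟪u (y + proj (D y)),
        ∑ c, distort G (fun z => v (z + proj (D z))) y c • ĝψ c y⟫_ℝ := by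
  have e1 : ∀ x, ⟪u x, ∑ a, v x a • gψ a x⟫_ℝ = ∑ i, ∑ a, u x i * v x a * gψ a x i := fun x =>
    inner_sum_smul_eq₂₈ _ _ _
  have e2 : ∀ y, ⟪u (y + proj (D y)), ∑ c, distort G (fun z => v (z + proj (D z))) y c • ĝψ c y⟫_ℝ =
      ∑ i, ∑ c, u (y + proj (D y)) i * (∑ a, G y c a * v (y + proj (D y)) a) * ĝψ c y i := by
    intro y
    rw [inner_sum_smul_eq₂₈]
    simp only [distort_apply]
  simp_rw [e1, e2]
  exact integral_transportPairing_comp_add_proj hD hX hJ hJG hu hv hψ hgψ hψg hĝψi hĝψ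

end Literature.Analysis.FluidPDE.Torus

namespace Literature.Analysis.FluidPDE.LatticeShear.LagrangianLatticeCarrier

open Literature.Analysis.FunctionSpaces Literature.Analysis.FluidPDE

/-- The flow derivative in coordinates: `(E.flowDeriv m t s y ℓ)_a = Σ_c (E.flowDeriv m t s y e_c)_a ℓ_c`
(`= (frameJac *ᵥ ℓ)_a`; linearity of the derivative on the standard basis).
[cite: ArmstrongVicol2025, §2.2 (PDF p. 18: the flows X_m and their distortion ∇X_m)] -/
theorem flowDeriv_apply_eq_sum_mul {k : ℕ} (E : LagrangianLatticeCarrier k) (m : ℕ) (t s : ℝ)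
    (y : UnitAddTorus (Fin 3)) (ℓ : EuclideanSpace ℝ (Fin 3)) (a : Fin 3) :
    (E.flowDeriv m t s y ℓ) a = ∑ c, (E.flowDeriv m t s y (EuclideanSpace.single c (1 : ℝ))) a * ℓ c := by
  have hv : ℓ = ∑ c, ℓ c • EuclideanSpace.single c (1 : ℝ) := by
    ext i
    simp only [WithLp.ofLp_sum, WithLp.ofLp_smul, Finset.sum_apply, Pi.smul_apply, smul_eq_mul,
      PiLp.ofLp_single]
    rw [Finset.sum_eq_single i (fun b _ hb => by simp [Ne.symm hb]) (by simp)]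
    simp
  conv_lhs => rw [hv]
  simp only [map_sum, map_smul]
  rw [WithLp.ofLp_sum]
  simp only [WithLp.ofLp_smul, Finset.sum_apply, Pi.smul_apply, smul_eq_mul]
  exact Finset.sum_congr rfl fun c _ => mul_comm _ _

/-- **The transport/stretching pairing in the frame of the coarse window flow of a regular Lagrangian
lattice carrier**: for `E.Regular`, `X = E.X m t s`, `J y = (∂_c X_a(y))` read off `E.flowDeriv` (the
Summit's `frameJac`), `G y = (J y)⁻¹` under `IsUnit (J y)` (the Summit's `frameG`), measurable `u, v`,
`ψ ∈ L²(𝕋³; ℝ³)` with `L²` weak gradients and ANY integrable weak gradients `ĝψ` of `ψ ∘ X`: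
`∫ Σ_i Σ_a u_i v_a (∂_a ψ)_i = ∫ Σ_i Σ_c u(X y)_i (G y · v(X y))_c (∂_c ψ̂)_i(y) dy`.
[cite: ArmstrongVicol2025, §4.1 (s_{m−1}, T_{m−1}), PDF p. 34; §2.2 (PDF p. 18)] [cite: Ziemer1989, Thm. 2.2.2] -/
theorem frameTransportPairing {k : ℕ} (E : LagrangianLatticeCarrier k) (hE : E.Regular) (m : ℕ) (t s : ℝ)
    (hU : ∀ y, IsUnit (Matrix.of fun a c => (E.flowDeriv m t s y (EuclideanSpace.single c (1 : ℝ))) a))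
    {u v : UnitAddTorus (Fin 3) → EuclideanSpace ℝ (Fin 3)}
    (hu : AEStronglyMeasurable u volume) (hv : AEStronglyMeasurable v volume)
    {ψ : UnitAddTorus (Fin 3) → EuclideanSpace ℝ (Fin 3)}
    {gψ : Fin 3 → UnitAddTorus (Fin 3) → EuclideanSpace ℝ (Fin 3)}
    (hψ : MemLp ψ 2 volume) (hgψ : ∀ a, MemLp (gψ a) 2 volume) (hψg : ∀ a, Torus.HasWeakPartialDeriv a ψ (gψ a))
    {ĝψ : Fin 3 → UnitAddTorus (Fin 3) → EuclideanSpace ℝ (Fin 3)} (hĝψi : ∀ c, Integrable (ĝψ c) volume)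
    (hĝψ : ∀ c, Torus.HasWeakPartialDeriv c (fun y => ψ (E.X m t s y)) (ĝψ c)) :
    ∫ x, ∑ i, ∑ a, u x i * v x a * gψ a x i =
      ∫ y, ∑ i, ∑ c, u (E.X m t s y) i *
        (∑ a, (Matrix.of fun a c => (E.flowDeriv m t s y (EuclideanSpace.single c (1 : ℝ))) a)⁻¹ c a *
          v (E.X m t s y) a) * ĝψ c y i := by
  set J : UnitAddTorus (Fin 3) → Matrix (Fin 3) (Fin 3) ℝ :=
    fun y => Matrix.of fun a c => (E.flowDeriv m t s y (EuclideanSpace.single c (1 : ℝ))) a with hJdef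
  have hD : Torus.IsSmooth (E.disp m t s) := hE.levelRegular.isSmooth_disp m t s
  have hX : MeasurePreserving (fun y => y + Torus.proj (E.disp m t s y)) volume volume :=
    hE.levelRegular.measurePreserving_X m t s
  have hJ : ∀ y a c, J y a c = (EuclideanSpace.single c (1 : ℝ)) a + (Torus.partialDeriv c (E.disp m t s) y) a :=
    fun y a c => by
      simp only [hJdef, Matrix.of_apply]
      exact flowDeriv_single_apply E hE m t s y a c
  have hJG : ∀ y, J y * (J y)⁻¹ = 1 := fun y =>
    Matrix.mul_nonsing_inv _ ((Matrix.isUnit_iff_isUnit_det _).mp (hU y))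
  exact Torus.integral_transportPairing_comp_add_proj hD hX hJ hJG hu hv hψ hgψ hψg hĝψi hĝψ

/-- **The transport term of the one-level window analysis, EXACTLY in the frame** (`IsInserted`): on the
refresh window `j` of level `m+1` (left end `w₀ = j·refresh (m+1)`, `t` in the window), the inserted level
field satisfies `b (m+1) t (X y) = DX(y) · level (m+1) t y`, so its pull-back is the Eulerian lattice
level, `(∇X)⁻¹ (b_{m+1} ∘ X) = level_{m+1}`, and for measurable `u`, `ψ ∈ H¹` and ANY integrable weak
gradients `ĝψ` of `ψ ∘ X`:
`∫ Σ_i Σ_a u_i (b_{m+1}(t))_a (∂_a ψ)_i dx = ∫ Σ_i Σ_c u(X y)_i (level_{m+1}(t) y)_c (∂_c ψ̂)_i(y) dy`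
("`∫ ⟪u, (b_{m+1}·∇)ψ⟫ = ∫ ⟪u∘X, (level_{m+1}·∇)ψ̂⟫`", brick Z6 transport term).
[cite: ArmstrongVicol2025, §2.2 (PDF p. 18: b_m inserted in the Lagrangian coordinates of X_{m−1}); §4.1 PDF p. 34] [cite: Ziemer1989, Thm. 2.2.2] -/
theorem frameTransportPairing_inserted {k : ℕ} (E : LagrangianLatticeCarrier k) (hE : E.Regular) (m : ℕ)
    (hI : E.IsInserted m) (j : ℤ) {w₀ t : ℝ} (hw₀ : w₀ = (j : ℝ) * E.refresh (m + 1))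
    (ht : t ∈ E.window (m + 1) j)
    (hU : ∀ y, IsUnit (Matrix.of fun a c => (E.flowDeriv m t w₀ y (EuclideanSpace.single c (1 : ℝ))) a))
    {u : UnitAddTorus (Fin 3) → EuclideanSpace ℝ (Fin 3)} (hu : AEStronglyMeasurable u volume)
    {ψ : UnitAddTorus (Fin 3) → EuclideanSpace ℝ (Fin 3)}
    {gψ : Fin 3 → UnitAddTorus (Fin 3) → EuclideanSpace ℝ (Fin 3)}
    (hψ : MemLp ψ 2 volume) (hgψ : ∀ a, MemLp (gψ a) 2 volume) (hψg : ∀ a, Torus.HasWeakPartialDeriv a ψ (gψ a))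
    {ĝψ : Fin 3 → UnitAddTorus (Fin 3) → EuclideanSpace ℝ (Fin 3)} (hĝψi : ∀ c, Integrable (ĝψ c) volume)
    (hĝψ : ∀ c, Torus.HasWeakPartialDeriv c (fun y => ψ (E.X m t w₀ y)) (ĝψ c)) :
    ∫ x, ∑ i, ∑ a, u x i * E.b (m + 1) t x a * gψ a x i =
      ∫ y, ∑ i, ∑ c, u (E.X m t w₀ y) i * E.toFractalCarrierData.level (m + 1) t y c * ĝψ c y i := by
  set J : UnitAddTorus (Fin 3) → Matrix (Fin 3) (Fin 3) ℝ :=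
    fun y => Matrix.of fun a c => (E.flowDeriv m t w₀ y (EuclideanSpace.single c (1 : ℝ))) a with hJdef
  have hv : AEStronglyMeasurable (E.b (m + 1) t) volume :=
    (hE.levelRegular.isSmooth_b m t).continuous.aestronglyMeasurable
  rw [frameTransportPairing E hE m t w₀ hU hu hv hψ hgψ hψg hĝψi hĝψ]
  refine integral_congr_ae (ae_of_all _ fun y => ?_)
  refine Finset.sum_congr rfl fun i _ => Finset.sum_congr rfl fun c _ => ?_
  -- the pull-back of the inserted level field is the Eulerian level: `(J⁻¹ · b (X y))_c = level_c`
  have hGJ : (J y)⁻¹ * J y = 1 :=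
    Matrix.nonsing_inv_mul _ ((Matrix.isUnit_iff_isUnit_det _).mp (hU y))
  have hb : ∀ a, E.b (m + 1) t (E.X m t w₀ y) a =
      ∑ c', J y a c' * E.toFractalCarrierData.level (m + 1) t y c' := by
    intro a
    have h1 := hI j t ht y
    rw [← hw₀] at h1
    rw [h1, flowDeriv_apply_eq_sum_mul]
    exact Finset.sum_congr rfl fun c' _ => by simp only [hJdef, Matrix.of_apply]
  have hpull : ∑ a, (J y)⁻¹ c a * E.b (m + 1) t (E.X m t w₀ y) a = E.toFractalCarrierData.level (m + 1) t y c := by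
    simp_rw [hb, Finset.mul_sum]
    rw [Finset.sum_comm]
    calc ∑ c', ∑ a, (J y)⁻¹ c a * (J y a c' * E.toFractalCarrierData.level (m + 1) t y c')
        = ∑ c', ((J y)⁻¹ * J y) c c' * E.toFractalCarrierData.level (m + 1) t y c' := by
          refine Finset.sum_congr rfl fun c' _ => ?_
          rw [Matrix.mul_apply, Finset.sum_mul]
          exact Finset.sum_congr rfl fun a _ => by ring
      _ = E.toFractalCarrierData.level (m + 1) t y c := by
          rw [hGJ]
          simp only [Matrix.one_apply, ite_mul, one_mul, zero_mul, Finset.sum_ite_eq, Finset.mem_univ,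
            if_true]
  rw [hpull]

end Literature.Analysis.FluidPDE.LatticeShear.LagrangianLatticeCarrier

end
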